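import Summits.BirchSwinnertonDyer.Rank1Residual.X5.SelmerSolitaireQuadratic
import HarnessLib

/-!
# X5 · Selmer solitaire, quadratic layer — Q8: RE-BASING a totally singular Lagrangian at a set of
# vertices `A` (the coordinate swap `u_ℓ ↔ t_ℓ`, `ℓ ∈ A`): cores translate by `n ↦ n ∆ A`

HONEST FRAMING (cell `b2b-bsdres`, run/shared/lean/b2b/bsd-rank1-residual/, verbatim in every
file): the goal of the cell is to DELETE the COMBINATION-SHAPED residual classes of the
Birch–Swinnerton-Dyer formula for ALL analytic-rank `≤ 1` elliptic curves over `ℚ` — "full BSD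
formula for every rank `≤ 1` curve in class `C`" assembled STRICTLY from published theorems — so
that the rank-`≤ 1` remainder becomes exactly the CONSTRUCTION-SHAPED classes, which are TYPED
(missing-input `Prop`s), NOT attempted. This is not "finishing BSD". O1 team (class X5, `p = 2`,
non-CM), ORDER v2.9 pool slot (ii‴) = lens-2 GEN 10's QUADRATIC-SPACE LAYER (o1 lead R-G20.3 /
R-G20.4, PLAN C150), item **Q8** (pool hand's offer, INBOX l.5512: the QS-level twin of the graph
layer's `pivotRebase_holds`, i.e. the step "[QS1/QS1c] after re-basing at any core vertex `A`
(coordinate swap `u_ℓ ↔ t_ℓ` on `A` = passing to the twist `E^{χ_A}`, (M4))" of lens-2's composition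
2G10.1; the swap-isometry was also x11b3-p2 GEN 6's suggested road, INBOX l.5300, recorded by the
o1 lead in PLAN C166); pool hand = seat `b2b-bsdres-x11b3-p3` GEN 8. PURE `𝔽₂` LINEAR ALGEBRA about the
vocabulary of `X5/SelmerSolitaireQuadratic.lean` (x11b3-p4, p283641): THEOREMS ONLY (no definition —
the swap is produced inside the proofs and exported existentially with its defining equations —, no
named fact, no `sorry`); nothing arithmetic is asserted (the dictionary "swap at `A` = quadratic twist
by `χ_A`" is (M4) of the AR layer and is NOT here); reach-neutral (R1 closes no class); nothing
booked; O1 OPEN.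

## What is proved (`A ⊆ D` arbitrary — no core hypothesis is needed for the transport itself)

* `Rebase.exists_swap`: there is a linear automorphism `σ_A` of `Q_D` with `σ_A x` = `x` with the two
  coordinates exchanged at every `ℓ ∈ A` (and unchanged at `∞` and at `ℓ ∉ A`); it is an involution,
  preserves `q` (`q(a u + b t) = a b` is symmetric), and maps `Λ_n` onto `Λ_{n ∆ A}` and `Λ*_n` onto
  `Λ*_{n ∆ A}` (`Rebase` lemmas `qform_swap`, `inLam_swap_iff`, `inLamStar_swap_iff`).
* **`exists_rebase`** (the export): for every totally singular Lagrangian `U` and every `A` there is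
  a totally singular Lagrangian `U′` (`= σ_A U`) with `CoreQ U′ n ↔ CoreQ U (n ∆ A)` for all `n`;
  in particular `A` core for `U` makes `∅` core for `U′`, where QS1's normal form applies
  (`exists_rebase_coreQ_empty`).

References: lens-2 GEN 10 (2G10.1, 2G10.4: re-basing = principal pivot `Ŝ ∗ A⁺`; Tucker 1960 /
Bouchet 1988 on the graph side, `X5/SelmerSolitairePivot*.lean`), `cells/o1/ROUTES-O1.md`;
B. Mazur, K. Rubin, *Kolyvagin systems*, Mem. AMS 799 (2004) §4.3 [cite: MazurRubin2004, §4.3];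
B. Poonen, E. Rains, JAMS 25 (2012) §4 [cite: PoonenRains2012, §4]. Folklore linear algebra.

## Tree search (dedup, 2026-08-21)
`lean search 'Quadratic.Rebase|exists_rebase|swap.*QVec'` in `Summits/` → none; the graph-layer
`pivotRebase_holds` (`X5/SelmerSolitairePivot.lean`) is about positions `P`, this file about
Lagrangians `U` — no statement in common. INBOX grep 'QuadraticRebase' → this hand's offer only.
-/

namespace Summit.BirchSwinnertonDyer.Rank1Residual.X5.SelmerSolitaire.Quadratic

open Finset SelmerSolitaire

variable {s : ℕ}

namespace Rebase

/-! ### §1 The coordinate swap at `A` -/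

/-- **The swap `σ_A`.** A linear automorphism of `Q_D` exchanging the `u`- and `t`-coordinates at
every vertex `ℓ ∈ A` and fixing the other coordinates; an involution. Produced here as data inside
an existential (no definition is added to the tree). [folklore] -/
theorem exists_swap (A : Finset (Fin s)) :
    ∃ σ : QVec s ≃ₗ[ZMod 2] QVec s,
      (∀ x, σ x none = x none) ∧
      (∀ x (l : Fin s), l ∈ A → σ x (some l) = ((x (some l)).2, (x (some l)).1)) ∧
      (∀ x (l : Fin s), l ∉ A → σ x (some l) = x (some l)) ∧
      (∀ x, σ (σ x) = x) := by
  classical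
  -- the underlying function
  let f : QVec s → QVec s := fun x v ↦
    match v with
    | none => x none
    | some l => if l ∈ A then ((x (some l)).2, (x (some l)).1) else x (some l)
  have hf_none : ∀ x, f x none = x none := fun _ ↦ rfl
  have hf_mem : ∀ x (l : Fin s), l ∈ A → f x (some l) = ((x (some l)).2, (x (some l)).1) :=
    fun x l hl ↦ by simp only [f, if_pos hl]
  have hf_not : ∀ x (l : Fin s), l ∉ A → f x (some l) = x (some l) :=
    fun x l hl ↦ by simp only [f, if_neg hl]
  have hf_inv : ∀ x, f (f x) = x := by
    intro x
    funext v
    cases v with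
    | none => rfl
    | some l =>
      by_cases hl : l ∈ A
      · rw [hf_mem _ l hl, hf_mem _ l hl]
      · rw [hf_not _ l hl, hf_not _ l hl]
  have hf_add : ∀ x y, f (x + y) = f x + f y := by
    intro x y
    funext v
    cases v with
    | none => rfl
    | some l =>
      by_cases hl : l ∈ A
      · rw [Pi.add_apply, hf_mem _ l hl, hf_mem _ l hl, hf_mem _ l hl]; rfl
      · rw [Pi.add_apply, hf_not _ l hl, hf_not _ l hl, hf_not _ l hl]; rfl
  have hf_smul : ∀ (c : ZMod 2) x, f (c • x) = c • f x := by
    intro c x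
    funext v
    cases v with
    | none => rfl
    | some l =>
      by_cases hl : l ∈ A
      · rw [Pi.smul_apply, hf_mem _ l hl, hf_mem _ l hl]; rfl
      · rw [Pi.smul_apply, hf_not _ l hl, hf_not _ l hl]; rfl
  refine ⟨{ toFun := f, invFun := f, map_add' := hf_add, map_smul' := hf_smul,
            left_inv := hf_inv, right_inv := hf_inv }, hf_none, hf_mem, hf_not, hf_inv⟩

/-- The swap preserves the quadratic form (`q(a u + b t) = a b = b a`). [cite: PoonenRains2012, §4] -/
theorem qform_swap {A : Finset (Fin s)} {σ : QVec s ≃ₗ[ZMod 2] QVec s}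
    (h0 : ∀ x, σ x none = x none)
    (h1 : ∀ x (l : Fin s), l ∈ A → σ x (some l) = ((x (some l)).2, (x (some l)).1))
    (h2 : ∀ x (l : Fin s), l ∉ A → σ x (some l) = x (some l)) (x : QVec s) :
    qform (σ x) = qform x := by
  unfold qform
  rw [Fintype.sum_option, Fintype.sum_option, h0]
  congr 1
  refine Finset.sum_congr rfl fun l _ ↦ ?_
  by_cases hl : l ∈ A
  · rw [h1 x l hl, mul_comm]
  · rw [h2 x l hl]

/-- The swap maps `Λ_n` onto `Λ_{n ∆ A}`: `σ_A x ∈ Λ_n ↔ x ∈ Λ_{n ∆ A}`. [cite: MazurRubin2004, §4.3] -/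
theorem inLam_swap_iff {A : Finset (Fin s)} {σ : QVec s ≃ₗ[ZMod 2] QVec s}
    (h1 : ∀ x (l : Fin s), l ∈ A → σ x (some l) = ((x (some l)).2, (x (some l)).1))
    (h2 : ∀ x (l : Fin s), l ∉ A → σ x (some l) = x (some l)) (n : Finset (Fin s)) (x : QVec s) :
    InLam n (σ x) ↔ InLam (symmDiff n A) x := by
  unfold InLam
  refine forall_congr' fun l ↦ ?_
  by_cases hl : l ∈ A
  · rw [h1 x l hl]
    have hmem : l ∈ symmDiff n A ↔ l ∉ n := by
      rw [Finset.mem_symmDiff]; tauto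
    rw [hmem]
    constructor
    · rintro ⟨ha, hb⟩; exact ⟨fun h ↦ hb h, fun h ↦ ha (not_not.mp h)⟩
    · rintro ⟨ha, hb⟩; exact ⟨fun h ↦ hb (not_not_intro h), fun h ↦ ha h⟩
  · rw [h2 x l hl]
    have hmem : l ∈ symmDiff n A ↔ l ∈ n := by
      rw [Finset.mem_symmDiff]; tauto
    rw [hmem]

/-- The swap maps `Λ*_n` onto `Λ*_{n ∆ A}` (it fixes the `∞`-coordinates). [cite: MazurRubin2004, §4.3] -/
theorem inLamStar_swap_iff {A : Finset (Fin s)} {σ : QVec s ≃ₗ[ZMod 2] QVec s}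
    (h0 : ∀ x, σ x none = x none)
    (h1 : ∀ x (l : Fin s), l ∈ A → σ x (some l) = ((x (some l)).2, (x (some l)).1))
    (h2 : ∀ x (l : Fin s), l ∉ A → σ x (some l) = x (some l)) (n : Finset (Fin s)) (x : QVec s) :
    InLamStar n (σ x) ↔ InLamStar (symmDiff n A) x := by
  unfold InLamStar
  rw [h0, inLam_swap_iff h1 h2]

/-- The image `σ_A U` of a totally singular Lagrangian is a totally singular Lagrangian. [folklore] -/
theorem isTSLagrangian_map {U : Submodule (ZMod 2) (QVec s)} (hU : IsTSLagrangian U)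
    {σ : QVec s ≃ₗ[ZMod 2] QVec s} (hq : ∀ x, qform (σ x) = qform x) :
    IsTSLagrangian (U.map (σ : QVec s →ₗ[ZMod 2] QVec s)) := by
  refine ⟨fun y hy ↦ ?_, ?_⟩
  · obtain ⟨x, hx, rfl⟩ := Submodule.mem_map.mp hy
    rw [LinearEquiv.coe_coe, hq]
    exact hU.1 x hx
  · rw [LinearEquiv.finrank_map_eq]
    exact hU.2

/-- Cores of `σ_A U` are the `A`-translates of the cores of `U`: `CoreQ (σ_A U) n ↔ CoreQ U (n ∆ A)`.
[cite: MazurRubin2004, §4.3] -/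
theorem coreQ_map_iff {U : Submodule (ZMod 2) (QVec s)} {A : Finset (Fin s)}
    {σ : QVec s ≃ₗ[ZMod 2] QVec s} (h0 : ∀ x, σ x none = x none)
    (h1 : ∀ x (l : Fin s), l ∈ A → σ x (some l) = ((x (some l)).2, (x (some l)).1))
    (h2 : ∀ x (l : Fin s), l ∉ A → σ x (some l) = x (some l)) (n : Finset (Fin s)) :
    CoreQ (U.map (σ : QVec s →ₗ[ZMod 2] QVec s)) n ↔ CoreQ U (symmDiff n A) := by
  constructor
  · intro h x hx hxn
    have h1' : σ x = 0 := h (σ x) (Submodule.mem_map_of_mem hx)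
      ((inLamStar_swap_iff h0 h1 h2 n x).mpr hxn)
    simpa using h1'
  · intro h y hy hyn
    obtain ⟨x, hx, rfl⟩ := Submodule.mem_map.mp hy
    rw [LinearEquiv.coe_coe] at hyn ⊢
    have hx0 : x = 0 := h x hx ((inLamStar_swap_iff h0 h1 h2 n x).mp hyn)
    rw [hx0, map_zero]

end Rebase

/-! ### §2 The export -/

/-- **QS-REBASE.** For every totally singular Lagrangian `U` of `Q_D` and every `A ⊆ D` there is a
totally singular Lagrangian `U′` — the image of `U` under the coordinate swap `u_ℓ ↔ t_ℓ` (`ℓ ∈ A`),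
exported together with that swap `σ` and its defining equations — whose core vertices are the
`A`-translates of those of `U`: `CoreQ U′ n ↔ CoreQ U (n ∆ A)`, and whose intersections with the
`Λ_n` correspond: `σ x ∈ Λ_n ↔ x ∈ Λ_{n ∆ A}`. This is the QS-level twin of the graph layer's
`pivotRebase_holds` (principal pivot `Ŝ ∗ A⁺`, Tucker / Bouchet) and the model of "passing to the
quadratic twist by `χ_A`" ((M4) of the AR layer, not asserted here). [cite: MazurRubin2004, §4.3] -/
theorem exists_rebase (U : Submodule (ZMod 2) (QVec s)) (hU : IsTSLagrangian U) (A : Finset (Fin s)) :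
    ∃ (σ : QVec s ≃ₗ[ZMod 2] QVec s) (U' : Submodule (ZMod 2) (QVec s)),
      U' = U.map (σ : QVec s →ₗ[ZMod 2] QVec s) ∧ IsTSLagrangian U' ∧
      (∀ x, σ x none = x none) ∧
      (∀ x (l : Fin s), l ∈ A → σ x (some l) = ((x (some l)).2, (x (some l)).1)) ∧
      (∀ x (l : Fin s), l ∉ A → σ x (some l) = x (some l)) ∧
      (∀ x, σ (σ x) = x) ∧
      (∀ n x, InLam n (σ x) ↔ InLam (symmDiff n A) x) ∧
      (∀ n, CoreQ U' n ↔ CoreQ U (symmDiff n A)) := by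
  obtain ⟨σ, h0, h1, h2, hinv⟩ := Rebase.exists_swap A
  exact ⟨σ, _, rfl, Rebase.isTSLagrangian_map hU (Rebase.qform_swap h0 h1 h2), h0, h1, h2, hinv,
    Rebase.inLam_swap_iff h1 h2, Rebase.coreQ_map_iff h0 h1 h2⟩

/-- **Re-basing at a core vertex makes `∅` core**: if `A` is core for `U` then `U` has a swap image
`U′` (a totally singular Lagrangian) with `∅` core and `CoreQ U′ n ↔ CoreQ U (n ∆ A)` — where QS1's
normal form `normalForm_holds` applies. [cite: MazurRubin2004, §4.3] -/
theorem exists_rebase_coreQ_empty (U : Submodule (ZMod 2) (QVec s)) (hU : IsTSLagrangian U)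
    {A : Finset (Fin s)} (hA : CoreQ U A) :
    ∃ U' : Submodule (ZMod 2) (QVec s), IsTSLagrangian U' ∧ CoreQ U' ∅ ∧
      ∀ n, CoreQ U' n ↔ CoreQ U (symmDiff n A) := by
  obtain ⟨σ, U', -, hU', -, -, -, -, -, hcore⟩ := exists_rebase U hU A
  refine ⟨U', hU', ?_, hcore⟩
  rw [hcore ∅]
  simpa [symmDiff] using hA

end Summit.BirchSwinnertonDyer.Rank1Residual.X5.SelmerSolitaire.Quadratic
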